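import Literature.AlgebraicTopology.FundamentalGroup.CircleAndTorus
import HarnessLib

/-!
# The winding homomorphism of a circle-valued map

Topic `Literature/AlgebraicTopology/FundamentalGroup` (infrastructure for the fact seat
`provefact-Literature.Topology.FourManifolds.Mazur1961_double_sphere_four`: the algebraic
intersection number of a loop with a two-sided hypersurface, read as the degree of the composite
with the Pontryagin–Thom collapse `X → ℝ/ℤ`).  Everything here is **proved**.

For a continuous `θ : X → ℝ/ℤ` and a base point `x`, the **winding homomorphism**
`π₁(X, x) → ℤ` is the composite of `θ_* : π₁(X, x) → π₁(ℝ/ℤ, θ x)` (Mathlib's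
`FundamentalGroup.map θ x`) with the isomorphism `π₁(ℝ/ℤ, θ x) ≅ ℤ` of Hatcher's Thm. 1.7 (the
tree's `fundamentalGroupAddCircleEquiv`, normalised by the winding loop); no new definition is
introduced for the composite.  Its value on the class of a loop `γ` is computed by any continuous
real lift `Λ` of `θ ∘ γ`: it is `Λ 1 - Λ 0` (Hatcher, proof of Thm. 1.7 with Prop. 1.30: lifts
are unique, the monodromy of the covering `ℝ → ℝ/ℤ` is translation by the increment of the lift;
tom Dieck, *Algebraic Topology* (2008), §2.7 "the winding number").

* `monodromy_coe_eq_of_lift` — the monodromy of `ℝ → ℝ/ℤ` along a loop with a given real lift;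
* `wind_fromPath_eq_of_lift` — the evaluation of the winding homomorphism by a real lift.

## References

* A. Hatcher, *Algebraic Topology*, CUP (2002), Thm. 1.7 (p. 29) and its proof, Prop. 1.30.
  [HatcherAT2002]
* T. tom Dieck, *Algebraic Topology*, EMS (2008), §2.7 (2.7.3)–(2.7.5). [tomDieck2008]
-/

noncomputable section

open scoped unitInterval
open Set Function

namespace Literature.AlgebraicTopology.FundamentalGroup

variable {X : Type*} [TopologicalSpace X]

/-- `θ_*` on the class of a loop is the class of the image loop. [folklore] -/
theorem map_fromPath_mk {Y : Type*} [TopologicalSpace Y] (θ : C(X, Y)) {x : X} (γ : Path x x) :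
    _root_.FundamentalGroup.map θ x (_root_.FundamentalGroup.fromPath (Path.Homotopic.Quotient.mk γ)) =
      _root_.FundamentalGroup.fromPath (Path.Homotopic.Quotient.mk (γ.map θ.continuous)) :=
  rfl

/-- **Monodromy of `ℝ → ℝ/ℤ` along a loop with a given real lift**: if `Λ` is a continuous real
lift of the loop `δ` of `ℝ/ℤ` starting at the point `e` of the fibre, the monodromy of the
covering carries `e` to `Λ 1` (uniqueness of lifts, Hatcher Prop. 1.30).
[cite: HatcherAT2002, Prop. 1.30] -/
theorem monodromy_coe_eq_of_lift {y : AddCircle (1 : ℝ)} (δ : Path y y)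
    (e : ((↑) : ℝ → AddCircle (1 : ℝ)) ⁻¹' {y}) (Λ : I → ℝ) (hΛ : Continuous Λ)
    (hlift : ∀ t, ((Λ t : ℝ) : AddCircle (1 : ℝ)) = δ t) (h0 : Λ 0 = e.1) :
    ((AddCircle.isCoveringMap_coe (1 : ℝ)).monodromy (Path.Homotopic.Quotient.mk δ) e : ℝ) =
      Λ 1 := by
  have hend : ((Λ 1 : ℝ) : AddCircle (1 : ℝ)) ∈ ({y} : Set (AddCircle (1 : ℝ))) := by
    rw [Set.mem_singleton_iff, hlift 1, δ.target]
  let Γ : Path e.1 (Λ 1) :=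
    { toFun := Λ
      continuous_toFun := hΛ
      source' := h0
      target' := rfl }
  have key : (AddCircle.isCoveringMap_coe (1 : ℝ)).monodromy (Path.Homotopic.Quotient.mk δ) e =
      ⟨Λ 1, hend⟩ := by
    refine (AddCircle.isCoveringMap_coe (1 : ℝ)).monodromy_eq_of_map_eq
      (Γ := Path.Homotopic.Quotient.mk Γ) ?_
    rw [← Path.Homotopic.Quotient.mk_map, ← Path.Homotopic.Quotient.mk_cast]
    congr 1
    ext t
    exact hlift t
  rw [key]

/-- **Evaluation of the winding homomorphism by a real lift** (Hatcher, proof of Thm. 1.7): if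
`Λ : [0, 1] → ℝ` is a continuous lift of `θ ∘ γ` (`Λ t mod 1 = θ (γ t)`) with
`Λ 1 = Λ 0 + n`, `n ∈ ℤ`, then the winding homomorphism `π₁(X, x) → π₁(ℝ/ℤ, θ x) ≅ ℤ` takes
the value `n` on `[γ]`.
[cite: HatcherAT2002, Thm. 1.7 (p. 29) and its proof, Prop. 1.30] -/
theorem wind_fromPath_eq_of_lift (θ : C(X, AddCircle (1 : ℝ))) {x : X} (γ : Path x x)
    (Λ : I → ℝ) (hΛ : Continuous Λ) (hlift : ∀ t, ((Λ t : ℝ) : AddCircle (1 : ℝ)) = θ (γ t))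
    (n : ℤ) (hn : Λ 1 = Λ 0 + n) :
    fundamentalGroupAddCircleEquiv one_ne_zero (θ x)
        (_root_.FundamentalGroup.map θ x
          (_root_.FundamentalGroup.fromPath (Path.Homotopic.Quotient.mk γ))) =
      Multiplicative.ofAdd n := by
  -- shift the lift so that it starts at the chosen point of the fibre
  set e := addCircleLift (θ x) with he
  have hex : ((e.1 : ℝ) : AddCircle (1 : ℝ)) = θ x := by
    have h2 := e.2
    rwa [Set.mem_preimage, Set.mem_singleton_iff] at h2
  have hΛ0 : ((Λ 0 : ℝ) : AddCircle (1 : ℝ)) = θ x := by rw [hlift 0, γ.source]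
  obtain ⟨k, hk⟩ : ∃ k : ℤ, (k : ℝ) = e.1 - Λ 0 := by
    have h : ((e.1 - Λ 0 : ℝ) : AddCircle (1 : ℝ)) = 0 := by
      rw [AddCircle.coe_sub, hex, hΛ0, sub_self]
    rw [AddCircle.coe_eq_zero_iff (1 : ℝ)] at h
    obtain ⟨k, hk⟩ := h
    exact ⟨k, by rw [← hk, zsmul_eq_mul, mul_one]⟩
  set Λ' : I → ℝ := fun t => Λ t + k with hΛ'
  have hΛ'c : Continuous Λ' := hΛ.add continuous_const
  have hlift' : ∀ t, ((Λ' t : ℝ) : AddCircle (1 : ℝ)) = (γ.map θ.continuous) t := by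
    intro t
    show (((Λ t + k : ℝ)) : AddCircle (1 : ℝ)) = θ (γ t)
    rw [AddCircle.coe_add, hlift t, (AddCircle.coe_eq_zero_iff (1 : ℝ)).2 ⟨k, by simp⟩, add_zero]
  have h0' : Λ' 0 = e.1 := by show Λ 0 + k = e.1; rw [hk]; ring
  have h1' : Λ' 1 = e.1 + n := by show Λ 1 + k = e.1 + n; rw [hn, hk]; ring
  -- the monodromy along `θ ∘ γ` is translation by `n`
  have hmono : ((AddCircle.isCoveringMap_coe (1 : ℝ)).monodromy
      (Path.Homotopic.Quotient.mk (γ.map θ.continuous)) e : ℝ) = e.1 + n := by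
    rw [monodromy_coe_eq_of_lift (γ.map θ.continuous) e Λ' hΛ'c hlift' h0', h1']
  have hmem : ((n : ℝ)) ∈ AddSubgroup.zmultiples (1 : ℝ) := ⟨n, by simp⟩
  have hdeck : (AddCircle.isAddQuotientCoveringMap_coe (1 : ℝ)).fundamentalGroupToMulOpposite e
      (_root_.FundamentalGroup.fromPath (Path.Homotopic.Quotient.mk (γ.map θ.continuous))) =
      MulOpposite.op (Multiplicative.ofAdd ⟨(n : ℝ), hmem⟩) := by
    rw [IsAddQuotientCoveringMap.fundamentalGroupToMulOpposite_apply_eq_Iff]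
    change _ = ((AddCircle.isCoveringMap_coe (1 : ℝ)).monodromy
      (Path.Homotopic.Quotient.mk (γ.map θ.continuous)) e : ℝ)
    rw [hmono]
    simp [MulOpposite.unop_op, AddSubgroup.vadd_def, add_comm]
  have hsymm : (intEquivZMultiples (1 : ℝ) one_ne_zero).symm ⟨(n : ℝ), hmem⟩ = n := by
    rw [AddEquiv.symm_apply_eq]
    apply Subtype.ext
    rw [intEquivZMultiples_apply_coe, mul_one]
  -- unfold the normalised isomorphism `π₁(ℝ/ℤ) ≅ ℤ`
  rw [map_fromPath_mk]
  simp only [fundamentalGroupAddCircleEquiv, MulEquiv.trans_apply,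
    IsAddQuotientCoveringMap.fundamentalGroupEquiv, IsQuotientCoveringMap.fundamentalGroupEquiv,
    MulEquiv.ofBijective_apply]
  change (AddEquiv.toMultiplicative (intEquivZMultiples (1 : ℝ) one_ne_zero).symm)
    ((MulOpposite.opMulEquiv (M := Multiplicative (AddSubgroup.zmultiples (1 : ℝ)))).symm
      ((AddCircle.isAddQuotientCoveringMap_coe (1 : ℝ)).fundamentalGroupToMulOpposite
        (addCircleLift (θ x))
        (_root_.FundamentalGroup.fromPath (Path.Homotopic.Quotient.mk (γ.map θ.continuous))))) = _
  rw [← he, hdeck]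
  simp [hsymm]

end Literature.AlgebraicTopology.FundamentalGroup
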